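import Literature.Claims.NS.Harbeck2025
import Literature.Analysis.FunctionSpaces.TorusSobolevNorm
import HarnessLib

/-!
# Claim skeleton C61b — Abu-Ghuwaleh 2026, «Global Regularity for the Three-Dimensional Periodic Incompressible Navier–Stokes Equations: A Shellwise–Microlocal Modified-Energy Proof»

**Cite header.** Mohammad Abu-Ghuwaleh (Zarqa University), *Global Regularity for the Three-Dimensional
Periodic Incompressible Navier–Stokes Equations: A Shellwise–Microlocal Modified-Energy Proof*, Zenodo
record **19559087** (doi:10.5281/zenodo.19559087; created 2026-04-13; CC-BY; 61 pp.; LaTeX; PDF page =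
printed page), bib key `AbuGhuwaleh2026b`. UNREFEREED PREPRINT under adjudication (D-0090 NS-claims sweep,
cell `ns-claims`, SUB-ROW C61b of C61 `AbuGhuwaleh2026` — a DIFFERENT ARGUMENT by the same author for
the same periodic claim; RULINGS v1.30c (1); QUICK grain on the chain named by ns-claims-lit-2 g3,
LOCATORS-Zenodo19559087-lit2.md). This file TYPES the claimed statement and selected load-bearing
displays as `Prop`s and asserts none of them; its only theorems are compositions by pure logic and the
Clay link by reuse of tree theorems. Nothing here is a theorem about Navier–Stokes. `(n)` = the
paper's display numbers, `p.` = page. [cite: AbuGhuwaleh2026b, Thm 1.1/1.2 p.3; Thm 4.2 p.10; Cor 12.6 p.59]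

**Setting (p.1–3, §2 pp.4–6).** (1) `∂ₜu + (u·∇)u + ∇p = νΔu`, `∇·u = 0` on `𝕋³ = [0,2π)³`, `ν > 0`,
unforced, `u₀ ∈ C^∞` divergence free; mean-zero reduction (2)–(4) (Prop 1.3 p.3, the Galilean change
of frame — in the tree `ClayVariants.clayPeriodic_regularity_of_torus_meanZero`); smooth dyadic
Littlewood–Paley blocks `v_j = Δ_j u`, `R_j = 2^j`, low field `a_j = P_{≤ j−K₀}u` (`K₀ ≥ 10`), low cutoff
`L_j = c_* R_j^{3/4}` «with c_* > 0 sufficiently small and fixed once and for all» (p.2); shell space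
`H_j` (5); blocks `V_J = (v_{J−M},…,v_{J+M})`, `‖V_J(t)‖²₂ = Σ_{m=−M}^{M}‖v_{J+m}(t)‖²_{L²}` for «a fixed
block width M ∈ ℕ» (p.3); energy inequality (8) `‖u(t)‖_{L²} ≤ ‖u₀‖_{L²}`; `Ω₁(k,p) := ν(|p|² + |k|² +
|k−p|²) ∼ νR²` (15) p.7. RENDERING (QUICK, as the cell's other periodic rows — `Harbeck2025`,
`Camlin2025`): the unit torus `UnitAddTorus (Fin 3)` of the tree (period immaterial by scaling,
`ClayVariants` §3 Δ1), classical solutions `Torus.IsClassicalNSSolutionOn`, SHARP dyadic shells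
`{2^j ≤ |k| < 2^{j+1}}` for the paper's smooth blocks (its cutoffs are not specified beyond «smooth,
real-valued, even», p.4; every constant below is existentially quantified, so the rendering changes no
decl's truth value by more than adjacent-shell slack — a refutation must be robust to it), Fourier
coefficients `mFourierCoeff` of the complexified field (tree convention, `Camlin2025.hsNorm`). The
finite-sum displays of §4 are typed at the grain the text proves them (TYPING-HYGIENE 13): over
arbitrary finitely supported arrays on the printed frequency supports.

**Claimed statement (verbatim, p.3).** «Theorem 1.1 (Global regularity on 𝕋³; official periodic
formulation). Let ν > 0 and let u₀ ∈ C^∞(𝕋³;ℝ³) be divergence free. Then the periodic incompressible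
Navier–Stokes system (1) admits a unique global smooth solution u ∈ C^∞([0,∞) × 𝕋³;ℝ³). Moreover, for
every Sobolev index s ≥ 0, sup_{t≥0}‖u(t)‖_{H^s(𝕋³)} < ∞.» «Theorem 1.2 (Mean-zero core theorem)» = the
same for mean-zero data `w₀`; «Proposition 1.3 … In particular, Theorem 1.2 implies Theorem 1.1.»
Typed: `ClaimedTheorem` = Theorem 1.2 (existence + the uniform-in-time `H^s` rider; uniqueness is
classical — tree `Torus.IsClassicalNSSolutionOn.velocity_unique_of_mem` — and not typed); its existence
core is VERBATIM the tree's `Harbeck2025.Thm11Existence` (`Thm12Core`, `core_of_claimed`), whence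
`clay_of_claimed : ClaimedTheorem → clayPeriodic.Regularity` by `Harbeck2025.clayB_of_thm11`
(Theorem 1.1 ⇐ Theorem 1.2 is Prop 1.3 = that tree bridge).

**Clay delta (reference `Literature.Claims.NS.ClayVariants`).** Nearest (B). Δ1 `𝕋³` (=); Δ2 (=); Δ3
`f ≡ 0` (=); Δ4 smooth divergence-free data, any mean (=); Δ5/Δ6 the rider «sup_{t≥0}‖u(t)‖_{H^s} < ∞ for
every s» is STRONGER than (B) (uniform-in-time bounds); Δ7 `ν > 0` arbitrary (=). No delta: `clay_of_claimed`
is PROVED. Were every Step to resist, the claim as typed decides (B) — escalation grade, never announced.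

**ORDERED STEP INDEX** (dependency order of the printed route p.6 l.−8 «The decisive high-frequency
input is the block absorption inequality of Theorem 12.5, derived from the corrected cubic
cancellation, the directional-compressed bilow estimate, the quartic and quintic normal forms, the
tri-low summation-by-parts mechanism, the exact-radius same-band chain, and the exact two-source cross
recursion»; §4 is the first of these inputs after the (true) cubic cancellation Prop 3.2 p.7):
* Step 1 = `Step1_Thm42_23` — Theorem 4.2 p.10, display (23) (proof p.10: `I₁ + I₂`). Lattice grain.
* Step 2 = `Step2_Thm42_2425` — Theorem 4.2 p.10, the chain from the last display of p.10 («|C_{η,j}(t)|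
  ≤ C_ν R^{−1/4} Σ_{k,p,p′} |â_j(p)||â_j(p′)||v̂_j(k)||v̂_j(k−(p−p′))|») through (24) («reorganise the low
  sum by direction class τ … we obtain (24)») and (25) («Σ_{(r,s)}Γ^{tan}_{j,τ}(r,s,t) ≲ R²‖a_{j,τ}(t)‖²,
  B♯_{j,τ}(r,s,t) ≤ ‖v_j(t)‖²», proof p.11 l.1–8: «The tangential active region has ≲ R^{5/4} points,
  while each fibre in the longitudinal variable has length ≲ R^{3/4}. Two applications of Cauchy–Schwarz
  therefore give (Σ_q F_{j,τ}(q,t))² ≲ R^{5/4}·R^{3/4}‖a_{j,τ}(t)‖² = R²‖a_{j,τ}(t)‖²») to p.11 l.9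
  («Summing over the finitely overlapping direction classes …»): together these assert that the
  absolute quadrilinear sum is `≤ C R² ‖a_j‖²‖v_j‖²`. Typed at the counting grain of that proof
  (`absSum`), independently of how the direction-class arrays `a_{j,τ}` are read. Companion
  `Step2L_Thm42_25a` = (25) first half in the LITERAL reading of p.9 («For a low frequency p ∈ ℤ³ we write
  p = (ρ,q)_τ», `F_{j,τ}(q) = Σ_ρ|â_j((ρ,q)_τ)|`, so that `Σ_{(r,s)}Γ^{tan}_{j,τ} = (Σ_q F_{j,τ}(q))² =
  (Σ_p |â_j(p)|)²` by the reindexing `B_τ ∈ GL(3,ℤ)`, Cor 2.3 — compare the text's own Prop 4.1 p.9).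
* Step 3 = `Step3_Thm42_26` — Theorem 4.2 (26) p.10 «|C_{η,j}(t)| ≤ C_ν R^{7/4}‖u₀‖²_{L²}‖v_j(t)‖²_{L²}»,
  the load-bearing OUTPUT of §4 (the R^{7/4} < R² gain that makes the bilow commutator (20) absorbable
  into the dissipation `c₀νR²‖v_j‖²` of (12)), typed at array grain with `‖a_j(t)‖²` in place of
  `‖u₀‖²` (the text's last step is (8)); `Cη` = (20) p.8 for real arrays.
* (support of Step 4, NOT typed — objects defined over pp.11–58: Prop 5.1/5.4 quartic–quintic
  smallness (31)–(32) p.11, (…) p.14; Thm 6.2/Cor 6.19 (134) p.35 tri-low operator bound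
  `‖S^{lo,ren}_j(t)‖ ≤ C_ν‖u₀‖³_{L²}R_j^{3/2}`; Thm 7.4 (151) p.38 Lyapunov gauge `‖A_{j,T}(t)‖ ≤ 1/16`;
  Thm 8.1 p.40; (173)/Lemma 9.3 p.43; Thm 9.6 p.44; Thm 11.3 p.55; Lemma 12.1 (237) p.56; (245) and
  Theorem 12.5 (246)–(247) p.58; (248)–(249) p.59.)
* Step 4 = `Step4_Cor126_250` — Corollary 12.6 (250) p.59: «‖V_J(t)‖²₂ ≤ C_{ν,ε,M}(‖V_J(0)‖²₂ + c_J)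
  e^{−cν2^{2J}t} for every J ≥ J_*, t ≥ 0», `c_J := C_{ν,ε}2^{−(2−ε)J}‖u₀‖⁴_{L²}` (p.56),
  `J_* = J_*(ν,ε,M,‖u₀‖_{L²})` (Thm 12.5 p.58) — the a-priori high-block decay, for EVERY smooth
  mean-zero solution on every `[0,T]`, with data-only constants. (ERRATUM-GRADE companion, not consumed:
  `Erratum251_rhsFinite` = p.59 l.12–13 «the right-hand side [of (251)] is finite for every t ≥ 0 because
  the initial data are smooth», at sequence grain.)
* Step 5 = `Step5_final` — p.59 (251)–(252) + l.24–27 «Combining the high-frequency estimate (251) with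
  the finite low-frequency bound (252) proves that every H^s-norm stays finite on [0,∞). Standard
  continuation for smooth periodic Navier–Stokes solutions then gives global smoothness. This proves
  Theorem 1.2»: the implication Step 4 ⇒ Theorem 1.2 (TYPING-HYGIENE 8: the glue is printed, one
  paragraph; typed as an implication between the typed Props, not invented).
COMPOSITION: `claim_of_steps : Step4_Cor126_250 → Step5_final → ClaimedTheorem` (PROVED, one line);
Steps 1–3 are the typed part of the printed support chain of Step 4 (not re-derived here);
`clay_of_claimed` PROVED. No verdict anywhere in this file.

WHAT THIS IS NOT: not a claim about NS regularity or blow-up; not a claim about any author beyond the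
typed locator.
-/

open Set MeasureTheory Literature.Analysis.FunctionSpaces Literature.Analysis.FluidPDE
open scoped ContDiff

namespace Literature.Claims.NS.AbuGhuwaleh2026b

noncomputable section

/-! ## Vocabulary (definitions with bodies; nothing asserted) -/

/-- The unit 3-torus (the paper's `𝕋³ = [0,2π)³` up to scaling). [cite: AbuGhuwaleh2026b, (1) p.1] -/
abbrev T3 : Type := UnitAddTorus (Fin 3)

/-- Physical / vector space `ℝ³`. [cite: AbuGhuwaleh2026b, Thm 1.1 p.3] -/
abbrev E3 : Type := EuclideanSpace ℝ (Fin 3)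

/-- The frequency lattice `ℤ³` (Fourier side, (9) p.4). [cite: AbuGhuwaleh2026b, (9) p.4] -/
abbrev Z3 : Type := Fin 3 → ℤ

/-- `|k|²` for `k ∈ ℤ³`, as an integer. [cite: AbuGhuwaleh2026b, §2.1 p.4] -/
def inormSq (k : Z3) : ℤ := ∑ i, k i ^ 2

/-- `|k|` for `k ∈ ℤ³` (the tree's `Torus.freqNormSq` under a square root). [cite: AbuGhuwaleh2026b, §2.1 p.4] -/
def lnorm (k : Z3) : ℝ := Real.sqrt (Torus.freqNormSq k)

/-- `ξ · α` for a lattice vector `ξ ∈ ℤ³` and a real 3-vector `α` (the dot products `ξ·â_j(p)`,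
`ζ·â_j(p)`, `η·â_j(p′)` of (17)–(23) pp.8–10). [cite: AbuGhuwaleh2026b, (17)–(20) p.8] -/
def dotZ (ξ : Z3) (α : E3) : ℝ := ∑ i, (ξ i : ℝ) * α i

/-- `Ω₁(k,p) := ν(|p|² + |k|² + |k−p|²)` (15) p.7. [cite: AbuGhuwaleh2026b, (15) p.7] -/
def Ω₁ (ν : ℝ) (k p : Z3) : ℝ :=
  ν * (Torus.freqNormSq p + Torus.freqNormSq k + Torus.freqNormSq (k - p))

/-- The absolute quadrilinear sum of p.10, last display:
`Σ_{k,p,p′} |â_j(p)| |â_j(p′)| |v̂_j(k)| |v̂_j(k − (p − p′))|`, over a low set `A` and a shell set `K`,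
for modulus arrays `a` (on `A`) and `v` (on `K`, zero elsewhere). The displays (24)–(25) and their
printed proof (p.11 l.1–8) involve only these moduli. [cite: AbuGhuwaleh2026b, p.10 last display; (24)–(25) p.10] -/
def absSum (A K : Finset Z3) (a v : Z3 → ℝ) : ℝ :=
  ∑ k ∈ K, ∑ p ∈ A, ∑ p' ∈ A, |a p| * |a p'| * |v k| * |v (k - (p - p'))|

/-- The bilow commutator piece `C_{η,j}` of (20) p.8 (with `ξ = k − p`, `η = k − p′`, `ζ = k − p − p′`,
`ℓ = p − p′`), written for REAL vector arrays `a` (low block) and `v` (shell) — the sub-case of fields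
even in `x` (then all Fourier coefficients are real and the `ℜ`/conjugation of (5)–(6) are vacuous):
`Σ_{k,p,p′} (η·a(p′)) (ξ·a(p)/Ω₁(k,p) − ζ·a(p)/Ω₁(k,p′)) v(k)·v(k − ℓ)`.
[cite: AbuGhuwaleh2026b, (20) p.8; (5)–(6) p.2] -/
def Cη (ν : ℝ) (A K : Finset Z3) (a v : Z3 → E3) : ℝ :=
  ∑ k ∈ K, ∑ p ∈ A, ∑ p' ∈ A,
    dotZ (k - p') (a p') *
      (dotZ (k - p) (a p) / Ω₁ ν k p - dotZ (k - p - p') (a p) / Ω₁ ν k p') *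
        @inner ℝ E3 _ (v k) (v (k - (p - p')))

/-- The SHARP dyadic shell `{k ∈ ℤ³ : 2^j ≤ |k| < 2^{j+1}}` (rendering of `supp v̂_j ⊂ {|k| ∼ R_j}`,
`R_j = 2^j`, p.2/p.5), as a finite set. [cite: AbuGhuwaleh2026b, §1 p.2; Lemma 2.2 p.5] -/
def shellSet (j : ℕ) : Finset Z3 :=
  (Fintype.piFinset fun _ : Fin 3 => Finset.Icc (-(2 ^ (j + 1) : ℤ)) (2 ^ (j + 1))).filter
    fun k => (4 : ℤ) ^ j ≤ inormSq k ∧ inormSq k < (4 : ℤ) ^ (j + 1)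

/-- `‖v_j(t)‖²_{L²}` rendered on the Fourier side: `Σ_{k ∈ shell j} ‖ŵ(k)‖²` for a field `w` on the
unit torus (Fourier coefficients of the complexified field, tree convention). [cite: AbuGhuwaleh2026b, (5) p.2; (11) p.6] -/
def shellEnergy (j : ℕ) (w : T3 → E3) : ℝ :=
  ∑ k ∈ shellSet j, ‖UnitAddTorus.mFourierCoeff (EuclideanSpace.complexify ∘ w) k‖ ^ 2

/-- `‖V_J(t)‖²₂ := Σ_{m=−M}^{M} ‖v_{J+m}(t)‖²_{L²}` (p.3 §1.2), for `J ≥ M`. [cite: AbuGhuwaleh2026b, §1.2 p.3] -/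
def blockEnergy (M J : ℕ) (w : T3 → E3) : ℝ :=
  ∑ m ∈ Finset.range (2 * M + 1), shellEnergy (J - M + m) w

/-- `‖w‖²_{L²(𝕋³)}`. [cite: AbuGhuwaleh2026b, (8) p.2] -/
def l2Sq (w : T3 → E3) : ℝ := ∫ x, ‖w x‖ ^ 2

/-! ## The claimed statement -/

/-- **Theorem 1.2 p.3 (mean-zero core theorem), as printed minus «unique»**: for every `ν > 0` and every
smooth, divergence-free, mean-zero `w₀` on `𝕋³` there is a global classical solution `(W, P)` on
`[0,∞)` with `W(0) = w₀`, AND for every Sobolev index `s ≥ 0`, `sup_{t ≥ 0} ‖W(t)‖_{H^s} < ∞` (tree norm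
`Torus.sobolevNorm` of the complexified field). [cite: AbuGhuwaleh2026b, Thm 1.2 p.3] -/
def ClaimedTheorem : Prop :=
  ∀ ν : ℝ, 0 < ν → ∀ w₀ : T3 → E3, Torus.IsSmooth w₀ → Torus.IsDivFree w₀ → Torus.HasZeroMean w₀ →
    ∃ (W : ℝ → T3 → E3) (P : ℝ → T3 → ℝ), Torus.IsClassicalNSSolutionOn (Ici 0) ν 0 W P ∧ W 0 = w₀ ∧
      ∀ s : ℝ, 0 ≤ s → ∃ Ms : ℝ, ∀ t : ℝ, 0 ≤ t →
        Torus.sobolevNorm s (EuclideanSpace.complexify ∘ W t) ≤ Ms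

/-- The existence-and-smoothness core of Theorem 1.2 is VERBATIM the tree's
`Harbeck2025.Thm11Existence` (same periodic mean-zero statement; reused, not restated).
[cite: AbuGhuwaleh2026b, Thm 1.2 p.3] -/
abbrev Thm12Core : Prop := Harbeck2025.Thm11Existence

/-- Theorem 1.2 as typed contains its existence core (drop the `H^s` rider). [cite: AbuGhuwaleh2026b, Thm 1.2 p.3] -/
theorem core_of_claimed (h : ClaimedTheorem) : Thm12Core := by
  intro ν hν w₀ hs hd hm
  obtain ⟨W, P, hW, hW0, _⟩ := h ν hν w₀ hs hd hm
  exact ⟨W, P, hW, hW0⟩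

/-- **Clay link (B)** — Prop 1.3 p.3 (Galilean restoration of the mean) is the tree bridge
`ClayVariants.clayPeriodic_regularity_of_torus_meanZero`, so the claim as typed implies Fefferman's
(B): NO wrong-problem delta. [cite: AbuGhuwaleh2026b, Prop 1.3 p.3] -/
theorem clay_of_claimed (h : ClaimedTheorem) : ClayVariants.clayPeriodic.Regularity :=
  Harbeck2025.clayB_of_thm11 (core_of_claimed h)

/-! ## The steps (none asserted) -/

/-- **Step 1 — Theorem 4.2 p.10, (23)**: «On the support |p|, |p′| ≤ L_j = c_*R^{3/4}, one has
|ξ·â_j(p)/Ω₁(k,p) − ζ·â_j(p)/Ω₁(k,p′)| ≤ C_ν R^{−5/4}|â_j(p)|» (`ξ = k − p`, `ζ = k − p − p′`, `|k| ∼ R`,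
`p·â_j(p) = 0`). Lattice grain, real vectors (even-field sub-case), shell rendered `R ≤ |k| ≤ 2R`.
[cite: AbuGhuwaleh2026b, Thm 4.2 (23) p.10] -/
def Step1_Thm42_23 : Prop :=
  ∀ ν cstar : ℝ, 0 < ν → 0 < cstar → cstar ≤ 1 →
    ∃ C : ℝ, ∀ R : ℝ, 1 ≤ R → ∀ k p p' : Z3,
      R ≤ lnorm k → lnorm k ≤ 2 * R →
      lnorm p ≤ cstar * R ^ (3 / 4 : ℝ) → lnorm p' ≤ cstar * R ^ (3 / 4 : ℝ) →
        ∀ α : E3, dotZ p α = 0 →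
          |dotZ (k - p) α / Ω₁ ν k p - dotZ (k - p - p') α / Ω₁ ν k p'| ≤
            C * R ^ (-(5 / 4 : ℝ)) * ‖α‖

/-- **Step 2 — Theorem 4.2 p.10–11, the chain (24)–(25)**: from the last display of p.10 through
(24) («reorganise the low sum by direction class τ, active tangential shift (r,s), and passive
longitudinal shift ℓ … we obtain (24)»), (25) («Σ_{(r,s)}Γ^{tan}_{j,τ}(r,s,t) ≲ R²‖a_{j,τ}(t)‖²_{L²},
B♯_{j,τ}(r,s,t) ≤ ‖v_j(t)‖²_{L²}», proof p.11 l.1–8) and «Summing over the finitely overlapping direction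
classes» (p.11 l.9): the absolute quadrilinear sum over the low block `|p|,|p′| ≤ c_*R^{3/4}` and the
shell `|k| ∼ R` is `≤ C·R²·‖a_j(t)‖²_{L²}·‖v_j(t)‖²_{L²}` with `C` independent of `R` and of the
arrays. Counting grain of the printed proof; `c_*` = the paper's fixed constant (any value in `(0,1]`).
[cite: AbuGhuwaleh2026b, Thm 4.2 (24)–(25) p.10; proof p.11 l.1–9] -/
def Step2_Thm42_2425 : Prop :=
  ∀ cstar : ℝ, 0 < cstar → cstar ≤ 1 →
    ∃ C : ℝ, ∀ R : ℝ, 1 ≤ R → ∀ (A K : Finset Z3) (a v : Z3 → ℝ),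
      (∀ p ∈ A, lnorm p ≤ cstar * R ^ (3 / 4 : ℝ)) →
      (∀ k ∈ K, R ≤ lnorm k ∧ lnorm k ≤ 2 * R) → (∀ k, k ∉ K → v k = 0) →
        absSum A K a v ≤ C * R ^ 2 * (∑ p ∈ A, a p ^ 2) * (∑ k ∈ K, v k ^ 2)

/-- **Step 2, literal companion — Theorem 4.2 (25) first half, p.10/p.11 l.1–8, in the literal reading
of p.9** (`a_{j,τ}` = `a_j` written in the `τ`-coordinates `p = (ρ,q)_τ` of a unimodular frame
`B_τ ∈ GL(3,ℤ)`, so `Σ_{(r,s)}Γ^{tan}_{j,τ}(r,s,t) = (Σ_q F_{j,τ}(q,t))² = (Σ_p |â_j(p,t)|)²`, the frame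
disappearing by reindexing, Cor 2.3): «(Σ_q F_{j,τ}(q,t))² ≲ R^{5/4}·R^{3/4}‖a_{j,τ}(t)‖²_{L²} =
R²‖a_{j,τ}(t)‖²_{L²}» — i.e. `(Σ_{|p| ≤ c_*R^{3/4}} |â_j(p)|)² ≤ C R² Σ_p |â_j(p)|²`. (Compare the text's
Proposition 4.1 p.9: «one only has the crude estimate ‖Γ_j‖_{ℓ¹} ≲ R^{9/4}‖a_j‖² … so a raw bound of the
form R^{1/4}‖u₀‖² is false in general».) [cite: AbuGhuwaleh2026b, Thm 4.2 (25) p.10; p.11 l.1–8; Prop 4.1 p.9] -/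
def Step2L_Thm42_25a : Prop :=
  ∀ cstar : ℝ, 0 < cstar → cstar ≤ 1 →
    ∃ C : ℝ, ∀ R : ℝ, 1 ≤ R → ∀ (A : Finset Z3) (a : Z3 → ℝ),
      (∀ p ∈ A, lnorm p ≤ cstar * R ^ (3 / 4 : ℝ)) →
        (∑ p ∈ A, |a p|) ^ 2 ≤ C * R ^ 2 * ∑ p ∈ A, a p ^ 2

/-- **Step 3 — Theorem 4.2 (26) p.10: «|C_{η,j}(t)| ≤ C_ν R^{7/4} ‖u₀‖²_{L²} ‖v_j(t)‖²_{L²}»** — the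
output of §4, at array grain (real vector arrays = even-field sub-case; `p·â_j(p) = 0`; `‖a_j(t)‖²` in
place of `‖u₀‖²`, the text's last step being the energy inequality (8)).
[cite: AbuGhuwaleh2026b, Thm 4.2 (26) p.10; (20) p.8] -/
def Step3_Thm42_26 : Prop :=
  ∀ ν cstar : ℝ, 0 < ν → 0 < cstar → cstar ≤ 1 →
    ∃ C : ℝ, ∀ R : ℝ, 1 ≤ R → ∀ (A K : Finset Z3) (a v : Z3 → E3),
      (∀ p ∈ A, lnorm p ≤ cstar * R ^ (3 / 4 : ℝ)) → (∀ p ∈ A, dotZ p (a p) = 0) →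
      (∀ k ∈ K, R ≤ lnorm k ∧ lnorm k ≤ 2 * R) → (∀ k, k ∉ K → v k = 0) →
        |Cη ν A K a v| ≤ C * R ^ (7 / 4 : ℝ) * (∑ p ∈ A, ‖a p‖ ^ 2) * (∑ k ∈ K, ‖v k‖ ^ 2)

/-- **Step 4 — Corollary 12.6 (250) p.59** (from Theorem 12.5 (246)–(247) p.58 and Lemma 12.1 (237)
p.56 by Grönwall, (248)–(249)): «‖V_J(t)‖²₂ ≤ C_{ν,ε,M}(‖V_J(0)‖²₂ + c_J) e^{−cν2^{2J}t} for every
J ≥ J_*, t ≥ 0», with `c_J := C_{ν,ε} 2^{−(2−ε)J} ‖u₀‖⁴_{L²}` (p.56), `J_* = J_*(ν, ε, M, ‖u₀‖_{L²})`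
(Thm 12.5), «for every finite horizon T > 0, every 0 ≤ t ≤ T», «uniform in T» (p.56/p.58), `ε ∈ (0,2)`
(Lemma 9.3), `M` the fixed block width: for every smooth mean-zero classical solution on `[0,T] × 𝕋³`
whose datum has `‖u₀‖²_{L²} = E₀`, every `J ≥ J_*` and `t ∈ [0,T]`. Sharp-shell rendering of the blocks
(module docstring). [cite: AbuGhuwaleh2026b, Cor 12.6 (250) p.59; Thm 12.5 p.58; (236)–(237) p.56] -/
def Step4_Cor126_250 : Prop :=
  ∀ ν ε : ℝ, 0 < ν → 0 < ε → ε < 2 → ∀ M : ℕ, 1 ≤ M → ∀ E0 : ℝ, 0 ≤ E0 →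
    ∃ Jstar : ℕ, M ≤ Jstar ∧ ∃ C c Cc : ℝ, 0 ≤ C ∧ 0 < c ∧ 0 ≤ Cc ∧
      ∀ (T : ℝ) (W : ℝ → T3 → E3) (P : ℝ → T3 → ℝ), 0 < T →
        Torus.IsClassicalNSSolutionOn (Icc 0 T) ν 0 W P → Torus.HasZeroMean (W 0) →
        l2Sq (W 0) = E0 →
          ∀ J : ℕ, Jstar ≤ J → ∀ t ∈ Icc 0 T,
            blockEnergy M J (W t) ≤
              C * (blockEnergy M J (W 0) + Cc * (2 : ℝ) ^ (-((2 - ε) * (J : ℝ))) * E0 ^ 2) *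
                Real.exp (-(c * ν * (4 : ℝ) ^ J * t))

/-- **ERRATUM-GRADE (not a Step; consumed by nothing)** — p.59 l.12–13, after (251): «the right-hand
side is finite for every t ≥ 0 because the initial data are smooth». At `t = 0` the right-hand side of
(251) is `Σ_{J ≥ J_*} 2^{2sJ}(‖V_J(0)‖²₂ + c_J)` with `c_J = C_{ν,ε}2^{−(2−ε)J}‖u₀‖⁴`; typed at
sequence grain: weighted summability of the data sequence `x_J = ‖V_J(0)‖²₂` (smooth data) would
give weighted summability with the `c_J` added. [cite: AbuGhuwaleh2026b, (251) p.59] -/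
def Erratum251_rhsFinite : Prop :=
  ∀ ε : ℝ, 0 < ε → ε < 2 → ∀ s : ℝ, 0 ≤ s → ∀ E0 Cc : ℝ, 0 < E0 → 0 < Cc →
    ∀ x : ℕ → ℝ, (∀ J, 0 ≤ x J) → Summable (fun J : ℕ => (4 : ℝ) ^ (s * (J : ℝ)) * x J) →
      Summable (fun J : ℕ =>
        (4 : ℝ) ^ (s * (J : ℝ)) * (x J + Cc * (2 : ℝ) ^ (-((2 - ε) * (J : ℝ))) * E0 ^ 2))

/-- **Step 5 — p.59, (251)–(252) and l.24–27**: «Combining the high-frequency estimate (251) with the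
finite low-frequency bound (252) proves that every H^s-norm stays finite on [0,∞). Standard continuation
for smooth periodic Navier–Stokes solutions then gives global smoothness. This proves Theorem 1.2.» —
the printed passage from the high-block decay (250) to Theorem 1.2, typed as the implication between
the typed Props. [cite: AbuGhuwaleh2026b, (251)–(252) p.59] -/
def Step5_final : Prop := Step4_Cor126_250 → ClaimedTheorem

/-! ## Compositions (pure logic) -/

/-- **COMPOSITION** — Corollary 12.6 (250) and the closing paragraph of §12 give Theorem 1.2 as typed.
[cite: AbuGhuwaleh2026b, §12.3 p.58–59] -/
theorem claim_of_steps (h4 : Step4_Cor126_250) (h5 : Step5_final) : ClaimedTheorem := h5 h4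

/-- With the steps, the claim would settle Clay (B) (no delta). [cite: AbuGhuwaleh2026b, Thm 1.1 p.3] -/
theorem clay_of_steps (h4 : Step4_Cor126_250) (h5 : Step5_final) :
    ClayVariants.clayPeriodic.Regularity :=
  clay_of_claimed (claim_of_steps h4 h5)


/-! ## Rev 2 (typist-6 g3, 2026-08-27, after VERDICT refuter-8 g2 04:23:01Z) — the CONE reading of
`a_{j,τ}` at fixed aperture (addendum decls for the MAP's reading-robustness cell; the locator of record
is `Step2_Thm42_2425`). p.9 l.77–90: «For each direction class τ, fix a unimodular lattice frame
B_τ ∈ GL(3,ℤ), adapted to the corresponding cone and uniformly well-conditioned»; §6.1 p.19 l.14: «Fix once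
and for all the same finite family of direction classes τ ∈ T». In the cone reading `a_{j,τ}` is `a_j`
restricted to the class `τ`, a cone of FIXED aperture (the family is finite and fixed, independent of `R`). -/

/-- A thin direction class around `e₁` of rational aperture `1/s`, `s ≥ 1`: the lattice square-cone
`{p ∈ ℤ³ : p₁ > 0, s|p₂| ≤ p₁, s|p₃| ≤ p₁}` (a cone «adapted to a lattice direction», p.9 l.77–90; every
member of a fixed finite family of cones covering `ℤ³∖{0}` contains such a square-cone around its axis
after a unimodular change of frame — recorded for the axis `e₁`, the case the countermodel needs).
[cite: AbuGhuwaleh2026b, §4 p.9 l.77–90; §6.1 p.19 l.13–14] -/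
def thinClass (s : ℕ) : Set Z3 :=
  {p | 0 < p 0 ∧ (s : ℤ) * |p 1| ≤ p 0 ∧ (s : ℤ) * |p 2| ≤ p 0}

/-- **Step 2T — Theorem 4.2 (25) first half p.10 / p.11 l.1–8 in the CONE reading at fixed aperture**:
for every aperture `1/s` and every `c_* ∈ (0,1]` a constant `C` (allowed to depend on `s`) with
`(Σ_{p ∈ A} |â_j(p)|)² ≤ C R² Σ_{p ∈ A} |â_j(p)|²` for all low sets `A ⊂ {|p| ≤ c_*R^{3/4}}` lying in ONE thin
class — what «(Σ_q F_{j,τ}(q,t))² ≲ R^{5/4}·R^{3/4}‖a_{j,τ}(t)‖²» asserts for `a_{j,τ} = a_j·𝟙_τ`. Weaker than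
`Step2L_Thm42_25a` (`step2T_of_step2L`), so its refutation is the stronger reading-robustness record: a
cone of fixed aperture `1/s` still holds `≍ s⁻² R^{9/4} ≫ R²` low lattice points.
[cite: AbuGhuwaleh2026b, Thm 4.2 (25) p.10; p.11 l.1–8; §4 p.9 l.77–90; §6.1 p.19 l.14] -/
def Step2T_Thm42_25a : Prop :=
  ∀ s : ℕ, 0 < s → ∀ cstar : ℝ, 0 < cstar → cstar ≤ 1 →
    ∃ C : ℝ, ∀ R : ℝ, 1 ≤ R → ∀ (A : Finset Z3) (a : Z3 → ℝ),
      (∀ p ∈ A, lnorm p ≤ cstar * R ^ (3 / 4 : ℝ)) → (∀ p ∈ A, p ∈ thinClass s) →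
        (∑ p ∈ A, |a p|) ^ 2 ≤ C * R ^ 2 * ∑ p ∈ A, a p ^ 2

/-- The literal face implies the thin-class face (drop the class hypothesis).
[cite: AbuGhuwaleh2026b, Thm 4.2 (25) p.10] -/
theorem step2T_of_step2L (h : Step2L_Thm42_25a) : Step2T_Thm42_25a := by
  intro s _ cstar hc hc1
  obtain ⟨C, hC⟩ := h cstar hc hc1
  exact ⟨C, fun R hR A a hA _ => hC R hR A a hA⟩


/-! ### Rev 2 (cont.) — the print-faithful quantifier on `c_*` (REF READ-BACK ref-1 g3 04:30:55Z, F2 delta;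
RETYPE.md §2 R#1). p.2 l.20–25: `L_j = c_* R^{3/4}` «with c_* > 0 sufficiently small and fixed once and for
all» — the print claims (24)–(25) for SOME small `c_*` (with `C = C(c_*)`); the Steps above quantify
`∀ c_* ∈ (0,1]` and the kill of record p495906 instantiates `c_* = 1`. The `_small` forms below are the
charitable re-typing R#1; `Step2_Thm42_2425 → Step2_Thm42_2425_small` (take `c₀ = 1`). -/

/-- **Step 2 with the print-faithful quantifier: `c_*` sufficiently small (p.2 l.25); weaker than
`Step2_Thm42_2425`.** There is `c₀ > 0` such that for every `c_* ∈ (0, c₀]` the chain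
p.10 last display → (24) → (25) → p.11 l.34 holds with some `C = C(c_*)`: `absSum ≤ C R² ‖a‖² ‖v‖²` for low
sets `A ⊂ {|p| ≤ c_*R^{3/4}}` and shell sets `K ⊂ {R ≤ |k| ≤ 2R}` (RETYPE.md §2 R#1 `Step2_smallCstar`, verbatim
body of `Step2_Thm42_2425`). [cite: AbuGhuwaleh2026b, p.2 l.20–25; Thm 4.2 (24)–(25) p.10; p.11 l.1–35] -/
def Step2_Thm42_2425_small : Prop :=
  ∃ c₀ : ℝ, 0 < c₀ ∧ ∀ cstar : ℝ, 0 < cstar → cstar ≤ c₀ →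
    ∃ C : ℝ, ∀ R : ℝ, 1 ≤ R → ∀ (A K : Finset Z3) (a v : Z3 → ℝ),
      (∀ p ∈ A, lnorm p ≤ cstar * R ^ (3 / 4 : ℝ)) →
      (∀ k ∈ K, R ≤ lnorm k ∧ lnorm k ≤ 2 * R) → (∀ k, k ∉ K → v k = 0) →
        absSum A K a v ≤ C * R ^ 2 * (∑ p ∈ A, a p ^ 2) * (∑ k ∈ K, v k ^ 2)

/-- **Step 2L with the print-faithful quantifier: `c_*` sufficiently small (p.2 l.25); weaker than
`Step2L_Thm42_25a`.** There is `c₀ > 0` such that for every `c_* ∈ (0, c₀]`, with some `C = C(c_*)`,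
`(Σ_{|p| ≤ c_*R^{3/4}} |â_j(p)|)² ≤ C R² Σ_p |â_j(p)|²` (RETYPE.md §2 R#1 `Step2L_smallCstar`, verbatim body of
`Step2L_Thm42_25a`). [cite: AbuGhuwaleh2026b, p.2 l.20–25; Thm 4.2 (25) p.10; p.11 l.1–8] -/
def Step2L_Thm42_25a_small : Prop :=
  ∃ c₀ : ℝ, 0 < c₀ ∧ ∀ cstar : ℝ, 0 < cstar → cstar ≤ c₀ →
    ∃ C : ℝ, ∀ R : ℝ, 1 ≤ R → ∀ (A : Finset Z3) (a : Z3 → ℝ),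
      (∀ p ∈ A, lnorm p ≤ cstar * R ^ (3 / 4 : ℝ)) →
        (∑ p ∈ A, |a p|) ^ 2 ≤ C * R ^ 2 * ∑ p ∈ A, a p ^ 2

/-- The typed Step 2 implies its small-`c_*` form (take `c₀ = 1`). [cite: AbuGhuwaleh2026b, p.2 l.25; Thm 4.2 p.10] -/
theorem step2_small_of_step2 (h : Step2_Thm42_2425) : Step2_Thm42_2425_small :=
  ⟨1, one_pos, fun cstar hc hc1 => h cstar hc hc1⟩

/-- The typed Step 2L implies its small-`c_*` form (take `c₀ = 1`). [cite: AbuGhuwaleh2026b, p.2 l.25; Thm 4.2 p.10] -/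
theorem step2L_small_of_step2L (h : Step2L_Thm42_25a) : Step2L_Thm42_25a_small :=
  ⟨1, one_pos, fun cstar hc hc1 => h cstar hc hc1⟩

/-- Contrapositive bookkeeping for the MAP: a kill of the small-`c_*` chain kills the typed chain.
[cite: AbuGhuwaleh2026b, Thm 4.2 (24)–(25) p.10] -/
theorem not_step2_of_not_small (h : ¬ Step2_Thm42_2425_small) : ¬ Step2_Thm42_2425 :=
  fun h2 => h (step2_small_of_step2 h2)

end

/-! ## Kernel certificate for Step 1 — Theorem 4.2 (23) p.10 (APPEND-ONLY, 2026-08-27; Literature-side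
twin of `Theorems/SoloSalvageAbuGhuwaleh2026bStep1.lean`, salvage-p6, p497212) -/

section Step1Certificate

open Finset

/-- `(ξ − η)·α = ξ·α − η·α`. (Proof device.) [folklore] -/
private theorem s1_dotZ_sub (ξ η : Z3) (α : E3) : dotZ (ξ - η) α = dotZ ξ α - dotZ η α := by
  simp only [dotZ, Pi.sub_apply, Int.cast_sub, sub_mul, Finset.sum_sub_distrib]

/-- `|k − p|² = |k|² − 2 k·p + |p|²` (the integer dot product written as a real sum). (Proof device.) [folklore] -/
private theorem s1_freqNormSq_sub (k p : Z3) :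
    Torus.freqNormSq (k - p) =
      Torus.freqNormSq k - 2 * (∑ i, (k i : ℝ) * (p i : ℝ)) + Torus.freqNormSq p := by
  simp only [Torus.freqNormSq, Pi.sub_apply, Int.cast_sub, Finset.mul_sum,
    ← Finset.sum_add_distrib, ← Finset.sum_sub_distrib]
  refine Finset.sum_congr rfl fun i _ => ?_
  ring

/-- `lnorm ξ ≥ 0`. (Proof device.) [folklore] -/
private theorem s1_lnorm_nonneg (ξ : Z3) : 0 ≤ lnorm ξ := Real.sqrt_nonneg _

/-- `(lnorm ξ)² = |ξ|²`. (Proof device.) [folklore] -/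
private theorem s1_lnorm_sq (ξ : Z3) : lnorm ξ ^ 2 = Torus.freqNormSq ξ := by
  unfold lnorm
  exact Real.sq_sqrt (Torus.freqNormSq_nonneg ξ)

/-- Cauchy–Schwarz: `|ξ·α| ≤ |ξ| ‖α‖`. (Proof device.) [folklore] -/
private theorem s1_abs_dotZ_le (ξ : Z3) (α : E3) : |dotZ ξ α| ≤ lnorm ξ * ‖α‖ := by
  have hcs :=
    Finset.sum_mul_sq_le_sq_mul_sq Finset.univ (fun i => (ξ i : ℝ)) (fun i => α i)
  have hα : ‖α‖ ^ 2 = ∑ i, α i ^ 2 := by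
    rw [EuclideanSpace.norm_eq, Real.sq_sqrt (Finset.sum_nonneg fun i _ => by positivity)]
    simp [Real.norm_eq_abs, sq_abs]
  have h2 : (dotZ ξ α) ^ 2 ≤ (lnorm ξ * ‖α‖) ^ 2 := by
    rw [mul_pow, s1_lnorm_sq, hα]
    unfold dotZ Torus.freqNormSq
    exact hcs
  exact abs_le_of_sq_le_sq h2 (mul_nonneg (s1_lnorm_nonneg ξ) (norm_nonneg α))

/-- Cauchy–Schwarz: `|k·p| ≤ |k| |p|`. (Proof device.) [folklore] -/
private theorem s1_abs_dotZZ_le (k p : Z3) : |∑ i, (k i : ℝ) * (p i : ℝ)| ≤ lnorm k * lnorm p := by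
  have hcs :=
    Finset.sum_mul_sq_le_sq_mul_sq Finset.univ (fun i => (k i : ℝ)) (fun i => (p i : ℝ))
  have h2 : (∑ i, (k i : ℝ) * (p i : ℝ)) ^ 2 ≤ (lnorm k * lnorm p) ^ 2 := by
    rw [mul_pow, s1_lnorm_sq, s1_lnorm_sq]
    unfold Torus.freqNormSq
    exact hcs
  exact abs_le_of_sq_le_sq h2 (mul_nonneg (s1_lnorm_nonneg k) (s1_lnorm_nonneg p))

/-- `Ω₁(k,p) ≥ ν|k|²`. (Proof device.) [folklore] -/
private theorem s1_Ω₁_ge (ν : ℝ) (hν : 0 < ν) (k p : Z3) : ν * lnorm k ^ 2 ≤ Ω₁ ν k p := by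
  unfold Ω₁
  rw [s1_lnorm_sq]
  have h1 := Torus.freqNormSq_nonneg p
  have h2 := Torus.freqNormSq_nonneg (k - p)
  nlinarith

/-- `Ω₁(k,p) − Ω₁(k,p′) = ν(2|p|² − 2|p′|² − 2k·p + 2k·p′)`. (Proof device.) [folklore] -/
private theorem s1_Ω₁_sub (ν : ℝ) (k p p' : Z3) :
    Ω₁ ν k p - Ω₁ ν k p' = ν * (2 * Torus.freqNormSq p - 2 * Torus.freqNormSq p'
      - 2 * (∑ i, (k i : ℝ) * (p i : ℝ)) + 2 * (∑ i, (k i : ℝ) * (p' i : ℝ))) := by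
  unfold Ω₁
  rw [s1_freqNormSq_sub k p, s1_freqNormSq_sub k p']
  ring

/-- `R^{−5/4} = R^{3/4}/R²` for `R > 0`. (Proof device.) [folklore] -/
private theorem s1_rpow_neg_five_quarters {R : ℝ} (hR : 0 < R) :
    R ^ (-(5 / 4 : ℝ)) = R ^ (3 / 4 : ℝ) / R ^ 2 := by
  rw [show (-(5 / 4 : ℝ)) = (3 / 4 : ℝ) - 2 by norm_num, Real.rpow_sub hR, Real.rpow_two]

/-- `R^{3/4} ≤ R` for `R ≥ 1`. (Proof device.) [folklore] -/
private theorem s1_rpow_three_quarters_le {R : ℝ} (hR : 1 ≤ R) : R ^ (3 / 4 : ℝ) ≤ R := by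
  calc R ^ (3 / 4 : ℝ) ≤ R ^ (1 : ℝ) := Real.rpow_le_rpow_of_exponent_le hR (by norm_num)
    _ = R := Real.rpow_one R

/-- **Step 1 — Theorem 4.2 (23) p.10 HOLDS** (kernel), with `C = 25/ν`: no small divisor
(`Ω₁(k,p) ≥ ν|k|² ≥ νR²` by (15)); with `p·α = 0`, `ξ·α = k·α`, `ζ·α = k·α − p′·α`, and
`|Ω₁(k,p) − Ω₁(k,p′)| ≤ 12νR·R^{3/4}`, whence `|…| ≤ (25/ν)R^{−5/4}‖α‖`. Literature-side twin of the
Summits-side first kernel proof `Summit.NavierStokesRegularity.NavierStokesRegularity.Theorems.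
AbuGhuwaleh2026b.step1_Thm42_23_holds` (`Theorems/SoloSalvageAbuGhuwaleh2026bStep1.lean`, seat
ns-claims-salvage-p6, p497212 — not importable from `Literature/`), copied so that the Literature fact
`Step1_Thm42_23` carries its `_holds` (D-0026 census). Step 1 true, Step 2 refuted (#114): no
verdict / locator / class consequence. [cite: AbuGhuwaleh2026b, Thm 4.2 (23) p.10; (15) p.7] -/
theorem step1_Thm42_23_holds : Step1_Thm42_23 := by
  intro ν cstar hν hc hc1
  refine ⟨25 / ν, ?_⟩
  intro R hR k p p' hkR hk2R hp hp' α hpα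
  have hR0 : 0 < R := by linarith
  set Q : ℝ := R ^ (3 / 4 : ℝ) with hQ_def
  have hQ0 : 0 ≤ Q := by positivity
  have hQR : Q ≤ R := s1_rpow_three_quarters_le hR
  have hP : lnorm p ≤ Q := hp.trans (by nlinarith [mul_le_of_le_one_left hQ0 hc1])
  have hP' : lnorm p' ≤ Q := hp'.trans (by nlinarith [mul_le_of_le_one_left hQ0 hc1])
  have hK0 : 0 ≤ lnorm k := s1_lnorm_nonneg k
  -- the two denominators
  set O : ℝ := Ω₁ ν k p with hO_def
  set O' : ℝ := Ω₁ ν k p' with hO'_def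
  have hR2 : ν * R ^ 2 ≤ ν * lnorm k ^ 2 := by
    have : R ^ 2 ≤ lnorm k ^ 2 := pow_le_pow_left₀ hR0.le hkR 2
    exact mul_le_mul_of_nonneg_left this hν.le
  have hO : ν * R ^ 2 ≤ O := hR2.trans (s1_Ω₁_ge ν hν k p)
  have hO' : ν * R ^ 2 ≤ O' := hR2.trans (s1_Ω₁_ge ν hν k p')
  have hνR2 : 0 < ν * R ^ 2 := by positivity
  have hOpos : 0 < O := hνR2.trans_le hO
  have hO'pos : 0 < O' := hνR2.trans_le hO'
  -- numerators
  set X : ℝ := dotZ k α with hX_def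
  set Y : ℝ := dotZ p' α with hY_def
  have hξ : dotZ (k - p) α = X := by rw [s1_dotZ_sub, hpα, sub_zero]
  have hζ : dotZ (k - p - p') α = X - Y := by rw [s1_dotZ_sub, hξ]
  have hX : |X| ≤ 2 * R * ‖α‖ :=
    (s1_abs_dotZ_le k α).trans (mul_le_mul_of_nonneg_right hk2R (norm_nonneg α))
  have hY : |Y| ≤ Q * ‖α‖ :=
    (s1_abs_dotZ_le p' α).trans (mul_le_mul_of_nonneg_right hP' (norm_nonneg α))
  -- the difference of the denominators
  have hΔ : |O' - O| ≤ 12 * ν * R * Q := by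
    have e := s1_Ω₁_sub ν k p' p
    rw [← hO_def, ← hO'_def] at e
    rw [e, abs_mul, abs_of_pos hν]
    have h1 : Torus.freqNormSq p ≤ Q ^ 2 := by
      rw [← s1_lnorm_sq]; exact pow_le_pow_left₀ (s1_lnorm_nonneg p) hP 2
    have h2 : Torus.freqNormSq p' ≤ Q ^ 2 := by
      rw [← s1_lnorm_sq]; exact pow_le_pow_left₀ (s1_lnorm_nonneg p') hP' 2
    have h3 : |∑ i, (k i : ℝ) * (p i : ℝ)| ≤ 2 * R * Q :=
      (s1_abs_dotZZ_le k p).trans (mul_le_mul hk2R hP (s1_lnorm_nonneg p) (by positivity))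
    have h4 : |∑ i, (k i : ℝ) * (p' i : ℝ)| ≤ 2 * R * Q :=
      (s1_abs_dotZZ_le k p').trans (mul_le_mul hk2R hP' (s1_lnorm_nonneg p') (by positivity))
    have h5 : Q ^ 2 ≤ R * Q := by nlinarith
    have hp0 := Torus.freqNormSq_nonneg p
    have hp0' := Torus.freqNormSq_nonneg p'
    have hin : |2 * Torus.freqNormSq p' - 2 * Torus.freqNormSq p
        - 2 * (∑ i, (k i : ℝ) * (p' i : ℝ)) + 2 * (∑ i, (k i : ℝ) * (p i : ℝ))| ≤ 12 * R * Q := by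
      rw [abs_le] at h3 h4 ⊢
      constructor <;> nlinarith
    calc ν * |2 * Torus.freqNormSq p' - 2 * Torus.freqNormSq p
          - 2 * (∑ i, (k i : ℝ) * (p' i : ℝ)) + 2 * (∑ i, (k i : ℝ) * (p i : ℝ))|
        ≤ ν * (12 * R * Q) := mul_le_mul_of_nonneg_left hin hν.le
      _ = 12 * ν * R * Q := by ring
  -- rewrite the expression
  have hE : dotZ (k - p) α / O - dotZ (k - p - p') α / O' =
      X * (O' - O) / (O * O') + Y / O' := by
    rw [hξ, hζ]
    field_simp
    ring
  rw [hE]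
  -- bound each term
  have hT1 : |X * (O' - O) / (O * O')| ≤
      (2 * R * ‖α‖) * (12 * ν * R * Q) / ((ν * R ^ 2) * (ν * R ^ 2)) := by
    rw [abs_div, abs_mul, abs_of_pos (mul_pos hOpos hO'pos)]
    have hnum : |X| * |O' - O| ≤ (2 * R * ‖α‖) * (12 * ν * R * Q) :=
      mul_le_mul hX hΔ (abs_nonneg _) (by positivity)
    have hden : (ν * R ^ 2) * (ν * R ^ 2) ≤ O * O' := mul_le_mul hO hO' hνR2.le hOpos.le
    exact div_le_div₀ (by positivity) hnum (by positivity) hden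
  have hT2 : |Y / O'| ≤ (Q * ‖α‖) / (ν * R ^ 2) := by
    rw [abs_div, abs_of_pos hO'pos]
    exact div_le_div₀ (by positivity) hY hνR2 hO'
  calc |X * (O' - O) / (O * O') + Y / O'|
      ≤ |X * (O' - O) / (O * O')| + |Y / O'| := abs_add_le _ _
    _ ≤ (2 * R * ‖α‖) * (12 * ν * R * Q) / ((ν * R ^ 2) * (ν * R ^ 2))
          + (Q * ‖α‖) / (ν * R ^ 2) := add_le_add hT1 hT2
    _ = 25 / ν * (Q / R ^ 2) * ‖α‖ := by
        field_simp
        ring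
    _ = 25 / ν * R ^ (-(5 / 4 : ℝ)) * ‖α‖ := by rw [s1_rpow_neg_five_quarters hR0]


end Step1Certificate

end Literature.Claims.NS.AbuGhuwaleh2026b
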